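import Mathlib.Algebra.BigOperators.Group.Finset.Piecewise
import Mathlib.Data.Finset.Max
import Mathlib.Data.Fintype.Powerset
import Mathlib.Tactic.Linarith
import Literature.Combinatorics.Optimization.HoffmanCirculation
import HarnessLib

/-!
# Hoffman's circulation theorem — proof (discharge of the named fact)

`theorem Hoffman1960_circulationTheorem_holds : Hoffman1960_circulationTheorem`, sorry-free, for the
named fact of `Literature/Combinatorics/Optimization/HoffmanCirculation.lean` (J. A. Bondy,
U. S. R. Murty, *Graph Theory*, GTM 244, Springer 2008, §20.3 Theorem 20.9 [BondyMurty2008]; original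
A. J. Hoffman, Proc. Sympos. Appl. Math. 10 (1960) 113–127). This sibling file holds only theorems;
the definitions (`outSum`, `inSum`, `IsFeasibleCirculation`) and the fact itself are imported
unchanged. Users holding `(h : Hoffman1960_circulationTheorem)` feed it
`Hoffman1960_circulationTheorem_holds`.

## Proof of Theorem 20.9 (`Hoffman1960_circulationTheorem_holds`)

Bondy–Murty print two proofs (held copy chunks p0444–p0446): from Farkas' Lemma (Proposition 20.12,
Corollary 20.13, Exercise 20.3.5), and constructively by `f`-improving paths for integer bounds (the
real case is their Exercise 20.3.1). Necessity of (20.6) is the printed argument (`f⁺(X) = f⁻(X)`,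
Exercises 7.3.1/20.2.4, and `b ≤ f ≤ c`): `inSum_le_outSum_of_isFeasibleCirculation`. For
sufficiency we take a shorter road, UNIFORM in the coefficient ring, so that part (i) (`ℝ`) and the
integrality addendum (ii) (`ℤ`) are one argument over any linearly ordered commutative ring `R`
(the standard tightening/uncrossing proof): induction on the number of arcs with `b a ≠ c a`. If
`b = c`, `f := b` is a circulation by (20.6) at `{v}` and `V ∖ {v}`; otherwise both bounds on such
an arc `a₀` are replaced by one value `t ∈ R`, which preserves (20.6) iff
`c a₀ − s(Y) ≤ t ≤ b a₀ + s(X)` whenever `a₀ ∈ ∂⁺(Y)`, `a₀ ∈ ∂⁻(X)` (`s(Z) := c⁺(Z) − b⁻(Z)`), and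
the largest lower bound is such a `t` by the uncrossing inequality
`s(X) + s(Y) ≥ s(X ∩ Y) + s(X ∪ Y) + (c − b)(a₀)` (`sub_le_slack_add_slack`).
Everything is proved inline; no named facts are introduced.
-/

namespace Literature.Combinatorics.Optimization

open Finset

section Proof

variable {V A : Type} [Fintype A] [DecidableEq V] (tail head : A → V) {R : Type} [CommRing R]

/-- `f⁺(X)` as a sum over all arcs of an indicator-weighted term. [folklore] -/
theorem outSum_eq_sum_ite (f : A → R) (X : Finset V) :
    outSum tail head f X = ∑ a, if tail a ∈ X ∧ head a ∉ X then f a else 0 := by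
  unfold outSum; rw [Finset.sum_filter]

/-- `f⁻(X)` as a sum over all arcs of an indicator-weighted term. [folklore] -/
theorem inSum_eq_sum_ite (f : A → R) (X : Finset V) :
    inSum tail head f X = ∑ a, if head a ∈ X ∧ tail a ∉ X then f a else 0 := by
  unfold inSum; rw [Finset.sum_filter]

/-- The net flow out of `X`, `f⁺(X) − f⁻(X)`, equals `Σ_a ([tail a ∈ X] − [head a ∈ X]) f(a)`
(arcs with both ends in `X` cancel). [cite: BondyMurty2008, Exercise 7.1.2] -/
theorem outSum_sub_inSum_eq_sum_ite (f : A → R) (X : Finset V) :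
    outSum tail head f X - inSum tail head f X =
      ∑ a, ((if tail a ∈ X then f a else 0) - (if head a ∈ X then f a else 0)) := by
  rw [outSum_eq_sum_ite, inSum_eq_sum_ite, ← Finset.sum_sub_distrib]
  refine Finset.sum_congr rfl fun a _ => ?_
  by_cases h1 : tail a ∈ X <;> by_cases h2 : head a ∈ X <;> simp [h1, h2]

/-- `f⁺(X) − f⁻(X) = Σ_{v ∈ X} (f⁺(v) − f⁻(v))`. [cite: BondyMurty2008, Exercise 7.1.2] -/
theorem outSum_sub_inSum_eq_sum_singleton (f : A → R) (X : Finset V) :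
    outSum tail head f X - inSum tail head f X =
      ∑ v ∈ X, (outSum tail head f {v} - inSum tail head f {v}) := by
  simp_rw [outSum_sub_inSum_eq_sum_ite, mem_singleton]
  rw [Finset.sum_comm]
  refine Finset.sum_congr rfl fun a _ => ?_
  rw [Finset.sum_sub_distrib, Finset.sum_ite_eq, Finset.sum_ite_eq]

/-- A circulation (`f⁺(v) = f⁻(v)` at every vertex) satisfies `f⁺(X) = f⁻(X)` for every `X ⊆ V`.
[cite: BondyMurty2008, Exercise 7.3.1 and Exercise 20.2.4] -/
theorem outSum_eq_inSum_of_conservation (f : A → R)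
    (hf : ∀ v : V, outSum tail head f {v} = inSum tail head f {v}) (X : Finset V) :
    outSum tail head f X = inSum tail head f X := by
  rw [← sub_eq_zero, outSum_sub_inSum_eq_sum_singleton]
  exact Finset.sum_eq_zero fun v _ => by rw [hf v, sub_self]

/-- Effect on `c⁺(X)` of changing the value of `c` on one arc `a₀`. [folklore] -/
theorem outSum_update (c : A → R) [DecidableEq A] (a₀ : A) (t : R) (X : Finset V) :
    outSum tail head (fun a => if a = a₀ then t else c a) X =
      outSum tail head c X + (if tail a₀ ∈ X ∧ head a₀ ∉ X then t - c a₀ else 0) := by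
  rw [outSum_eq_sum_ite, outSum_eq_sum_ite]
  have h : ∀ a, (if tail a ∈ X ∧ head a ∉ X then (if a = a₀ then t else c a) else 0) =
      (if tail a ∈ X ∧ head a ∉ X then c a else 0) +
        (if a = a₀ then (if tail a ∈ X ∧ head a ∉ X then t - c a else 0) else 0) := by
    intro a
    by_cases ha : a = a₀
    · subst ha
      by_cases hP : tail a ∈ X ∧ head a ∉ X <;> simp [hP]
    · simp [ha]
  simp_rw [h]
  rw [Finset.sum_add_distrib, Finset.sum_ite_eq' univ a₀, if_pos (mem_univ _)]

/-- Effect on `b⁻(X)` of changing the value of `b` on one arc `a₀`. [folklore] -/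
theorem inSum_update (b : A → R) [DecidableEq A] (a₀ : A) (t : R) (X : Finset V) :
    inSum tail head (fun a => if a = a₀ then t else b a) X =
      inSum tail head b X + (if head a₀ ∈ X ∧ tail a₀ ∉ X then t - b a₀ else 0) := by
  rw [inSum_eq_sum_ite, inSum_eq_sum_ite]
  have h : ∀ a, (if head a ∈ X ∧ tail a ∉ X then (if a = a₀ then t else b a) else 0) =
      (if head a ∈ X ∧ tail a ∉ X then b a else 0) +
        (if a = a₀ then (if head a ∈ X ∧ tail a ∉ X then t - b a else 0) else 0) := by
    intro a
    by_cases ha : a = a₀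
    · subst ha
      by_cases hP : head a ∈ X ∧ tail a ∉ X <;> simp [hP]
    · simp [ha]
  simp_rw [h]
  rw [Finset.sum_add_distrib, Finset.sum_ite_eq' univ a₀, if_pos (mem_univ _)]

section Compl

variable [Fintype V]

/-- `∂⁻(V ∖ X) = ∂⁺(X)`, hence `f⁻(V ∖ X) = f⁺(X)`. [cite: BondyMurty2008, §2.5 (cuts)] -/
theorem inSum_compl (f : A → R) (X : Finset V) :
    inSum tail head f Xᶜ = outSum tail head f X := by
  unfold inSum outSum; congr 1; ext a
  simpa only [mem_filter, mem_univ, true_and, mem_compl, not_not] using And.comm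

/-- `∂⁺(V ∖ X) = ∂⁻(X)`, hence `f⁺(V ∖ X) = f⁻(X)`. [cite: BondyMurty2008, §2.5 (cuts)] -/
theorem outSum_compl (f : A → R) (X : Finset V) :
    outSum tail head f Xᶜ = inSum tail head f X := by
  unfold inSum outSum; congr 1; ext a
  simpa only [mem_filter, mem_univ, true_and, mem_compl, not_not] using And.comm

end Compl

section Ordered

variable [LinearOrder R] [IsStrictOrderedRing R]

/-- Necessity of (20.6): a feasible circulation forces `b⁻(X) ≤ f⁻(X) = f⁺(X) ≤ c⁺(X)`.
[cite: BondyMurty2008, §20.3, derivation of (20.6)] -/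
theorem inSum_le_outSum_of_isFeasibleCirculation (b c f : A → R)
    (hf : IsFeasibleCirculation tail head b c f) (X : Finset V) :
    inSum tail head b X ≤ outSum tail head c X := by
  obtain ⟨hcons, hbd⟩ := hf
  calc inSum tail head b X ≤ inSum tail head f X := Finset.sum_le_sum fun a _ => (hbd a).1
    _ = outSum tail head f X := (outSum_eq_inSum_of_conservation tail head f hcons X).symm
    _ ≤ outSum tail head c X := Finset.sum_le_sum fun a _ => (hbd a).2

/-- The uncrossing inequality behind the tightening step: for an arc `a₀ ∈ ∂⁻(X) ∩ ∂⁺(Y)` and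
slacks `s(Z) := c⁺(Z) − b⁻(Z)`, `c(a₀) − b(a₀) ≤ s(X) + s(Y)`: `s(X) + s(Y) − s(X ∩ Y) − s(X ∪ Y)`
is `(c − b)` summed over the arcs between `X ∖ Y` and `Y ∖ X`, all terms `≥ 0`. [folklore] -/
theorem sub_le_slack_add_slack (b c : A → R) (hle : ∀ a, b a ≤ c a)
    (hcut : ∀ X : Finset V, inSum tail head b X ≤ outSum tail head c X) (a₀ : A)
    (X Y : Finset V) (hX : head a₀ ∈ X ∧ tail a₀ ∉ X) (hY : tail a₀ ∈ Y ∧ head a₀ ∉ Y) :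
    c a₀ - b a₀ ≤ (outSum tail head c X - inSum tail head b X) +
      (outSum tail head c Y - inSum tail head b Y) := by
  have h1 := hcut (X ∩ Y)
  have h2 := hcut (X ∪ Y)
  -- the crossing term `(c - b)(∂⁺(Y ∖ X) ∩ ∂⁻(X ∖ Y))`, which contains the arc `a₀`
  have h3 : c a₀ - b a₀ ≤
      ∑ a, if tail a ∈ Y ∧ tail a ∉ X ∧ head a ∈ X ∧ head a ∉ Y then c a - b a else 0 := by
    have h := Finset.single_le_sum (s := (univ : Finset A))
      (f := fun a => if tail a ∈ Y ∧ tail a ∉ X ∧ head a ∈ X ∧ head a ∉ Y then c a - b a else 0)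
      (fun a _ => ?_) (mem_univ a₀)
    · simpa [hX.1, hX.2, hY.1, hY.2] using h
    · show (0 : R) ≤ if _ then _ else _
      split_ifs; exacts [sub_nonneg.mpr (hle a), le_rfl]
  -- pointwise comparison, arc by arc (16 cases on where the two ends of the arc lie)
  have h4 : (outSum tail head c (X ∩ Y) - inSum tail head b (X ∩ Y)) +
      (outSum tail head c (X ∪ Y) - inSum tail head b (X ∪ Y)) +
      (∑ a, if tail a ∈ Y ∧ tail a ∉ X ∧ head a ∈ X ∧ head a ∉ Y then c a - b a else 0) ≤
      (outSum tail head c X - inSum tail head b X) +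
      (outSum tail head c Y - inSum tail head b Y) := by
    simp only [outSum_eq_sum_ite, inSum_eq_sum_ite, ← Finset.sum_sub_distrib,
      ← Finset.sum_add_distrib]
    refine Finset.sum_le_sum fun a _ => ?_
    have hle_a := hle a
    by_cases p1 : tail a ∈ X <;> by_cases p2 : tail a ∈ Y <;> by_cases q1 : head a ∈ X <;>
      by_cases q2 : head a ∈ Y <;> simp [p1, p2, q1, q2]
    all_goals linarith
  linarith [sub_nonneg.mpr h1, sub_nonneg.mpr h2]

variable [Fintype V]

omit [IsStrictOrderedRing R] in
/-- Base case of the tightening induction: if `b = c` satisfies (20.6) then `f := b` is a feasible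
circulation ((20.6) at `{v}` gives `b⁻(v) ≤ b⁺(v)`, at `V ∖ {v}` it gives `b⁺(v) ≤ b⁻(v)`).
[folklore] -/
theorem isFeasibleCirculation_self_of_forall_eq (b c : A → R) (hbc : ∀ a, b a = c a)
    (hcut : ∀ X : Finset V, inSum tail head b X ≤ outSum tail head c X) :
    IsFeasibleCirculation tail head b c b := by
  have hcb : c = b := funext fun a => (hbc a).symm
  rw [hcb] at hcut
  refine ⟨fun v => le_antisymm ?_ (hcut {v}), fun a => ⟨le_rfl, (hbc a).le⟩⟩
  simpa only [inSum_compl, outSum_compl] using hcut {v}ᶜ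

/-- The tightening step: under (20.6) and `b ≤ c`, for any arc `a₀` there is a common value
`t ∈ R`, `b(a₀) ≤ t ≤ c(a₀)`, such that setting `b(a₀) := t =: c(a₀)` preserves (20.6) (`t` is the
largest of the lower bounds `b(a₀)` and `c(a₀) − s(Y)`, `a₀ ∈ ∂⁺(Y)`). [folklore] -/
theorem exists_tightening_value (b c : A → R) (hle : ∀ a, b a ≤ c a)
    (hcut : ∀ X : Finset V, inSum tail head b X ≤ outSum tail head c X) (a₀ : A) :
    ∃ t : R, b a₀ ≤ t ∧ t ≤ c a₀ ∧
      (∀ X : Finset V, tail a₀ ∈ X → head a₀ ∉ X →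
        inSum tail head b X ≤ outSum tail head c X + (t - c a₀)) ∧
      (∀ X : Finset V, head a₀ ∈ X → tail a₀ ∉ X →
        inSum tail head b X + (t - b a₀) ≤ outSum tail head c X) := by
  by_cases hloop : tail a₀ = head a₀
  · -- a loop lies in no cut: nothing to preserve
    exact ⟨b a₀, le_rfl, hle a₀, fun X h1 h2 => absurd (hloop ▸ h1) h2,
      fun X h1 h2 => absurd h1 (hloop ▸ h2)⟩
  · obtain ⟨X₀, hX₀F, hX₀⟩ := Finset.exists_max_image
      (univ.filter (fun X : Finset V => tail a₀ ∈ X ∧ head a₀ ∉ X))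
      (fun X => c a₀ - (outSum tail head c X - inSum tail head b X))
      ⟨{tail a₀}, mem_filter.mpr
        ⟨mem_univ _, mem_singleton_self _, fun h => hloop (mem_singleton.mp h).symm⟩⟩
    simp only [mem_filter, mem_univ, true_and] at hX₀F hX₀
    refine ⟨max (b a₀) (c a₀ - (outSum tail head c X₀ - inSum tail head b X₀)), le_max_left _ _,
      max_le (hle a₀) (by linarith [hcut X₀]), fun X h1 h2 => ?_, fun X h1 h2 => ?_⟩
    · have hXle := hX₀ X ⟨h1, h2⟩
      have hmax := le_max_right (b a₀) (c a₀ - (outSum tail head c X₀ - inSum tail head b X₀))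
      linarith
    · have hk := sub_le_slack_add_slack tail head b c hle hcut a₀ X X₀ ⟨h1, h2⟩ hX₀F
      have hmax : max (b a₀) (c a₀ - (outSum tail head c X₀ - inSum tail head b X₀)) ≤
          outSum tail head c X - inSum tail head b X + b a₀ :=
        max_le (by linarith [hcut X]) (by linarith)
      linarith

/-- Sufficiency of (20.6), uniformly over a linearly ordered commutative ring `R` (so with `R = ℤ`
it is the integrality addendum): by induction on the number of arcs with `b a ≠ c a`, tightening one
arc at a time (`exists_tightening_value`). [cite: BondyMurty2008, §20.3 Theorem 20.9] -/
theorem exists_isFeasibleCirculation_of_card_le [DecidableEq A] (n : ℕ) :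
    ∀ b c : A → R, (univ.filter (fun a => b a ≠ c a)).card ≤ n → (∀ a, b a ≤ c a) →
      (∀ X : Finset V, inSum tail head b X ≤ outSum tail head c X) →
      ∃ f : A → R, IsFeasibleCirculation tail head b c f := by
  induction n with
  | zero =>
    intro b c hcard hle hcut
    refine ⟨b, isFeasibleCirculation_self_of_forall_eq tail head b c (fun a => ?_) hcut⟩
    by_contra h
    have hmem : a ∈ univ.filter (fun a => b a ≠ c a) := mem_filter.mpr ⟨mem_univ _, h⟩
    have hpos := Finset.card_pos.mpr ⟨a, hmem⟩
    omega
  | succ n ih =>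
    intro b c hcard hle hcut
    by_cases hall : ∀ a, b a = c a
    · exact ⟨b, isFeasibleCirculation_self_of_forall_eq tail head b c hall hcut⟩
    obtain ⟨a₀, ha₀⟩ := not_forall.mp hall
    obtain ⟨t, ht1, ht2, ht3, ht4⟩ := exists_tightening_value tail head b c hle hcut a₀
    -- the tightened bounds: one fewer arc with distinct bounds, still `b' ≤ c'`, still (20.6)
    have hcard' : (univ.filter (fun a => (if a = a₀ then t else b a) ≠
        (if a = a₀ then t else c a))).card ≤ n := by
      have hsub : univ.filter (fun a => (if a = a₀ then t else b a) ≠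
          (if a = a₀ then t else c a)) ⊆ (univ.filter (fun a => b a ≠ c a)).erase a₀ := by
        intro a ha
        rw [mem_filter] at ha
        rw [mem_erase, mem_filter]
        by_cases h : a = a₀
        · rw [if_pos h, if_pos h] at ha
          exact absurd rfl ha.2
        · rw [if_neg h, if_neg h] at ha
          exact ⟨h, mem_univ _, ha.2⟩
      have hmem : a₀ ∈ univ.filter (fun a => b a ≠ c a) := mem_filter.mpr ⟨mem_univ _, ha₀⟩
      have h1 := Finset.card_le_card hsub
      have h2 := Finset.card_erase_of_mem hmem
      omega
    have hle' : ∀ a, (if a = a₀ then t else b a) ≤ (if a = a₀ then t else c a) := fun a => by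
      by_cases h : a = a₀
      · rw [if_pos h, if_pos h]
      · rw [if_neg h, if_neg h]; exact hle a
    have hcut' : ∀ X : Finset V, inSum tail head (fun a => if a = a₀ then t else b a) X ≤
        outSum tail head (fun a => if a = a₀ then t else c a) X := by
      intro X
      rw [inSum_update, outSum_update]
      by_cases h1 : tail a₀ ∈ X <;> by_cases h2 : head a₀ ∈ X
      · rw [if_neg (fun h => h.2 h1), if_neg (fun h => h.2 h2), add_zero, add_zero]; exact hcut X
      · rw [if_neg (fun h => h.2 h1), if_pos ⟨h1, h2⟩, add_zero]; exact ht3 X h1 h2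
      · rw [if_pos ⟨h2, h1⟩, if_neg (fun h => h.2 h2), add_zero]; exact ht4 X h2 h1
      · rw [if_neg (fun h => h2 h.1), if_neg (fun h => h1 h.1), add_zero, add_zero]; exact hcut X
    obtain ⟨f, hf1, hf2⟩ := ih (fun a => if a = a₀ then t else b a)
      (fun a => if a = a₀ then t else c a) hcard' hle' hcut'
    -- a circulation feasible for the tightened bounds is feasible for the original ones
    refine ⟨f, hf1, fun a => ?_⟩
    obtain ⟨h1, h2⟩ := hf2 a
    by_cases ha : a = a₀
    · subst ha
      exact ⟨le_trans ht1 (by simpa using h1), le_trans (by simpa using h2) ht2⟩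
    · exact ⟨by simpa [ha] using h1, by simpa [ha] using h2⟩

end Ordered

end Proof

/-- **Hoffman's circulation theorem holds** (discharge of `Hoffman1960_circulationTheorem`,
Bondy–Murty 2008 Theorem 20.9): part (i) over `ℝ` — necessity by
`inSum_le_outSum_of_isFeasibleCirculation`, sufficiency by the tightening induction
`exists_isFeasibleCirculation_of_card_le` at `R = ℝ`; part (ii) is the same induction at `R = ℤ`.
[cite: BondyMurty2008, §20.3 Theorem 20.9] -/
theorem Hoffman1960_circulationTheorem_holds : Hoffman1960_circulationTheorem := by
  refine ⟨?_, ?_⟩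
  · intro V A _ _ _ tail head b c hle
    constructor
    · rintro ⟨f, hf⟩
      exact inSum_le_outSum_of_isFeasibleCirculation tail head b c f hf
    · intro hcut
      classical
      exact exists_isFeasibleCirculation_of_card_le tail head _ b c le_rfl hle hcut
  · intro V A _ _ _ tail head b c hle hcut
    classical
    exact exists_isFeasibleCirculation_of_card_le tail head _ b c le_rfl hle hcut

end Literature.Combinatorics.Optimization
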